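import Summits.QuantumFields.YangMills.Theorems.UnitScaleTiltProp8ChartQuadraticFlat
import Summits.QuantumFields.YangMills.Theorems.UnitScaleTiltProp8FlatProp4Dressing
import Summits.QuantumFields.YangMills.Theorems.UnitScaleTiltProp8FlatProp4Bg1CubeSeq
import Summits.QuantumFields.YangMills.Theorems.UnitScaleTiltProp8FlatCubeSequenceAdm
import HarnessLib

/-!
# Route `UnitScaleTilt`, crux K1 «MinimiserStabilityRegPr» (stmt-QuantumFields-19200), leaf V2′ `stub_halvingStep` — the C_E node ON THE CHART OF RECORD
# (print's double-bar chart `chartLogFlat`, ★★OWNER RULINGS g26-№6∕№7∕№11): **(152) SIZES OF `A′ = A + Hs(C♭ A)` AND THE (98) LETTER OF THE DRESSED CURRENT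
# `W = W₀∘(1 − Hs∘C♭) + E` AT THE CUBE SEQUENCE**, from hCq♭ (✓`chartRemainderFlat_hCd_hCq_B1`) and the two rows of the level-scaled `flatH` extension `Hs`

Cell `ym3-torus` (HUMAN RULING D-0037, YM ladder rung R3 — continuum SU(2) YM₃ on the torus is a RUNG, not the Clay problem), width seat `ym-ust-19200-w5` gen 3
(LEAD (S3)).  `--supports stmt-QuantumFields-19200 --as helper`; def-free, 0 sorry, standard axioms.  The ♭ RE-CUT of the seat's banked single-bar knits
(`size152_bond`∕`size152_of_flatH`, `hWq_dressed_cubeSeq`).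

OBJECTS.  `η = L^{−(K−n)}`; level weights `w` (`IsLevWeight`); `Q♭ := chartLogFlat η D`, `C♭ A := Q♭ A − (fderiv ℂ Q♭ 0) A` (its hCd∕hCq: ✓`Prop8ChartDoubleBar.
chartRemainderFlat_hCd_hCq_B1`, radius `Rs∕4`, `Rs = (60800·ℓ²·L)⁻¹`, constant `64L∕Rs`); `Hs` = ANY ℂ-linear map with the two (46) rows at constant `B₀` for UNWEIGHTED
index data (DISPLAYED hypotheses `hHB`, `hHG` — inhabited by ✓`FlatHDressingShape.exists_flatH_scaledExt` (iii)(iv), the `H` of record `Hs`, RULING №11).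
* §1 ★ **`size152_flat`** — for every admissible family (`Adm22 D R′ M`, `2L ≤ R′`, `1 ≤ M`): if `w 1 b·‖A b‖ ≤ δ < Rs∕4` and `w 2 b·L^{K−n}·‖A(b+e_ν) − A(b)‖ ≤ δ′` then
  `A′ := A + Hs(C♭ A)` has `w 1 b·‖A′ b‖ ≤ δ + B₀·(64L∕Rs)·δ²` and `w 2 b·L^{K−n}·‖A′(b+e_ν) − A′(b)‖ ≤ δ′ + B₀·(64L∕Rs)·δ²` ((152): the slice change of variables costs
  `O(δ²)` in BOTH letters, k-uniformly).
* §2 ★★ **`hWq_dressed_flat_cubeSeq`** — at the cube sequence `cubeSeqMT3 F n K x₀ ρ S M` (`2L ≤ S`, `2L ≤ R′`, `R′·M ≤ S`): P3b's pure-action gradient `W₀` (✓ p600749,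
  its (grad) identity exported) is such that for EVERY such `Hs` and EVERY dressing `E` with a quadratic letter `C_E` below `Rs∕4`, the dressed current
  `W Y := W₀ (Y − Hs (C♭ Y)) + E Y` obeys hypothesis (iii) of ✓`row165_of_tracePairing_L5_anyW` ∕ `existsUnique_smallSolution158_dom` VERBATIM:
  `r′ < a₃ → (w 1-size ≤ r′) → (w 2·L^{K−n}-gradient ≤ r′) → w 3 b·‖W Y b‖ ≤ C₄·r′²`, `a₃ = min (Rs∕8) (1∕(2L(1 + 4B₀C₂Rs∕8)))`, `C₂ = 16L∕Rs`,
  `C₄ = 12L³(1428+L)(1 + 4B₀C₂Rs∕8)² + C_E` (✓`FlatProp4Dressing.hWq_of_dressing`, unguarded rows).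
HONEST SCOPE: plumbing on the chart of record; `C_E` ((X1) sharp `∂*∂`-row, WANTED №g26-1 as re-opened under ♭) and `E`'s formula stay displayed.  NOT a claim about the mass gap.

References: T. Bałaban, CMP **102** (1985) 277–309 [Balaban1985Variational] ((44)–(48) p.285, (55) p.286, (80)–(89) pp.290–291, Prop. 4 (97)–(98) pp.292–293,
(152)–(158) pp.301–302, (165) p.304).
-/

set_option autoImplicit false

noncomputable section

open Set
open scoped BigOperators Matrix.Norms.L2Operator

namespace Summit.QuantumFields.YangMills.Theorems.HalvingSize152Flat

open Literature.MathematicalPhysics.QuantumFieldTheory.Balaban1983to89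
open B6SectADomainsV1 (Domains)
open B6SectAOperatorsV1 (BondIdx)
open T3ContinuumYM3Torus (T3Family)
open Summit.QuantumFields.YangMills.Theorems.FlatCubeOpsText (Adm22 IsLevWeight)
open Summit.QuantumFields.YangMills.Theorems.FlatOpsLettersAssembly (levWeight_nonneg)
open Summit.QuantumFields.YangMills.Theorems.FlatCubeSequenceAligned (cubeSeqMT3)
open Summit.QuantumFields.YangMills.Theorems.Prop8ChartDoubleBar (chartLogFlat chartRemainderFlat_hCd_hCq_B1)

/-! ## §1 (152): the sizes of `A′ = A + Hs(C♭ A)` -/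

/-- **(152) SIZES ON THE CHART OF RECORD** (see the module docstring). [cite: Balaban1985Variational, (152) p.301, (44)-(46) p.285, (157) p.302] -/
theorem size152_flat (F : T3Family) (n K : ℕ) {R' M : ℕ} (hR'L : 2 * (F.P K).L ≤ R') (hM : 1 ≤ M) (D : Domains (F.P K)) (hDk : D.k = K - n)
    (hAdm : Adm22 D R' M) {w : ℕ → PBond (F.P K) 0 → ℝ} (hw : IsLevWeight F n K D w)
    (Hs : (BondIdx D → Matrix (Fin 2) (Fin 2) ℂ) →ₗ[ℂ] (PBond (F.P K) 0 → Matrix (Fin 2) (Fin 2) ℂ)) {B₀ : ℝ}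
    (hHB : ∀ (X : BondIdx D → Matrix (Fin 2) (Fin 2) ℂ) (t : ℝ), (∀ c, ‖X c‖ ≤ t) → ∀ b, w 1 b * ‖Hs X b‖ ≤ B₀ * t)
    (hHG : ∀ (X : BondIdx D → Matrix (Fin 2) (Fin 2) ℂ) (t : ℝ), (∀ c, ‖X c‖ ≤ t) → ∀ (b : PBond (F.P K) 0) (ν : Fin 3),
      w 2 b * (F.L : ℝ) ^ (K - n) * ‖Hs X ⟨b.src.shift ν, b.dir⟩ - Hs X b‖ ≤ B₀ * t)
    (A : PBond (F.P K) 0 → Matrix (Fin 2) (Fin 2) ℂ) {δ δ' : ℝ}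
    (hδ : δ < (16 * 3800 * ((((F.P K).d + 2) * (F.P K).L : ℕ) : ℝ) ^ 2 * (F.L : ℝ))⁻¹ / 4)
    (h1 : ∀ b, w 1 b * ‖A b‖ ≤ δ) (h2 : ∀ (b : PBond (F.P K) 0) (ν : Fin 3), w 2 b * (F.L : ℝ) ^ (K - n) * ‖A ⟨b.src.shift ν, b.dir⟩ - A b‖ ≤ δ') :
    let C : (PBond (F.P K) 0 → Matrix (Fin 2) (Fin 2) ℂ) → BondIdx D → Matrix (Fin 2) (Fin 2) ℂ := fun Y i =>
      chartLogFlat (((F.L : ℝ)⁻¹) ^ (K - n)) D Y i -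
        (fderiv ℂ (chartLogFlat (((F.L : ℝ)⁻¹) ^ (K - n)) D :
          (PBond (F.P K) 0 → Matrix (Fin 2) (Fin 2) ℂ) → BondIdx D → Matrix (Fin 2) (Fin 2) ℂ) 0) Y i
    (∀ b, w 1 b * ‖(A + Hs (C A)) b‖ ≤
        δ + B₀ * ((64 * (F.L : ℝ) / (16 * 3800 * ((((F.P K).d + 2) * (F.P K).L : ℕ) : ℝ) ^ 2 * (F.L : ℝ))⁻¹) * δ ^ 2)) ∧
      ∀ (b : PBond (F.P K) 0) (ν : Fin 3),
        w 2 b * (F.L : ℝ) ^ (K - n) * ‖(A + Hs (C A)) ⟨b.src.shift ν, b.dir⟩ - (A + Hs (C A)) b‖ ≤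
          δ' + B₀ * ((64 * (F.L : ℝ) / (16 * 3800 * ((((F.P K).d + 2) * (F.P K).L : ℕ) : ℝ) ^ 2 * (F.L : ℝ))⁻¹) * δ ^ 2) := by
  intro C
  obtain ⟨-, hCq⟩ := chartRemainderFlat_hCd_hCq_B1 F n K hR'L hM D hDk hAdm hw
  set Rs : ℝ := (16 * 3800 * ((((F.P K).d + 2) * (F.P K).L : ℕ) : ℝ) ^ 2 * (F.L : ℝ))⁻¹ with hRs
  have hw0 : ∀ m b, 0 ≤ w m b := levWeight_nonneg hw
  -- the remainder at `A` is `O(δ²)` at every index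
  have hCA : ∀ c, ‖C A c‖ ≤ (64 * (F.L : ℝ) / Rs) * δ ^ 2 := fun c => hCq A δ hδ h1 c
  have hHB' := hHB (C A) _ hCA
  have hHG' := hHG (C A) _ hCA
  refine ⟨fun b => ?_, fun b ν => ?_⟩
  · calc w 1 b * ‖(A + Hs (C A)) b‖ = w 1 b * ‖A b + Hs (C A) b‖ := rfl
      _ ≤ w 1 b * (‖A b‖ + ‖Hs (C A) b‖) := mul_le_mul_of_nonneg_left (norm_add_le _ _) (hw0 1 b)
      _ = w 1 b * ‖A b‖ + w 1 b * ‖Hs (C A) b‖ := mul_add _ _ _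
      _ ≤ δ + B₀ * ((64 * (F.L : ℝ) / Rs) * δ ^ 2) := add_le_add (h1 b) (hHB' b)
  · have e : (A + Hs (C A)) ⟨b.src.shift ν, b.dir⟩ - (A + Hs (C A)) b =
        (A ⟨b.src.shift ν, b.dir⟩ - A b) + (Hs (C A) ⟨b.src.shift ν, b.dir⟩ - Hs (C A) b) := by
      simp only [Pi.add_apply]; abel
    rw [e]
    have hw2 : 0 ≤ w 2 b * (F.L : ℝ) ^ (K - n) := mul_nonneg (hw0 2 b) (by positivity)
    calc w 2 b * (F.L : ℝ) ^ (K - n) * ‖(A ⟨b.src.shift ν, b.dir⟩ - A b) + (Hs (C A) ⟨b.src.shift ν, b.dir⟩ - Hs (C A) b)‖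
        ≤ w 2 b * (F.L : ℝ) ^ (K - n) * (‖A ⟨b.src.shift ν, b.dir⟩ - A b‖ + ‖Hs (C A) ⟨b.src.shift ν, b.dir⟩ - Hs (C A) b‖) :=
          mul_le_mul_of_nonneg_left (norm_add_le _ _) hw2
      _ = w 2 b * (F.L : ℝ) ^ (K - n) * ‖A ⟨b.src.shift ν, b.dir⟩ - A b‖ +
            w 2 b * (F.L : ℝ) ^ (K - n) * ‖Hs (C A) ⟨b.src.shift ν, b.dir⟩ - Hs (C A) b‖ := mul_add _ _ _
      _ ≤ δ' + B₀ * ((64 * (F.L : ℝ) / Rs) * δ ^ 2) := add_le_add (h2 b ν) (hHG' b ν)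

/-! ## §2 (98) for the dressed current at the cube sequence, on the chart of record -/

/-- **HYPOTHESIS (iii) OF THE (165)-A₁ ROW FOR `W = W₀∘(1 − Hs∘C♭) + E` AT THE CUBE SEQUENCE** (see the module docstring for every symbol and constant).
[cite: Balaban1985Variational, Prop. 4 (97)-(98) pp.292-293, (80)-(89) pp.290-291, (157)-(158) p.302, (165) p.304] -/
theorem hWq_dressed_flat_cubeSeq (F : T3Family) (n K : ℕ) (x₀ : Site (F.P K) 0) (ρ S M R' : ℕ) (hM : 1 ≤ M) (hS : 2 * F.L ≤ S)
    (hR'L : 2 * (F.P K).L ≤ R') (hRS : R' * M ≤ S) {w : ℕ → PBond (F.P K) 0 → ℝ} (hw : IsLevWeight F n K (cubeSeqMT3 F n K x₀ ρ S M hM) w)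
    {B₀ C_E : ℝ} (hB₀ : 0 ≤ B₀) :
    let D := cubeSeqMT3 F n K x₀ ρ S M hM
    let Rs : ℝ := (16 * 3800 * ((((F.P K).d + 2) * (F.P K).L : ℕ) : ℝ) ^ 2 * (F.L : ℝ))⁻¹
    let C : (PBond (F.P K) 0 → Matrix (Fin 2) (Fin 2) ℂ) → BondIdx D → Matrix (Fin 2) (Fin 2) ℂ := fun Y i =>
      chartLogFlat (((F.L : ℝ)⁻¹) ^ (K - n)) D Y i -
        (fderiv ℂ (chartLogFlat (((F.L : ℝ)⁻¹) ^ (K - n)) D :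
          (PBond (F.P K) 0 → Matrix (Fin 2) (Fin 2) ℂ) → BondIdx D → Matrix (Fin 2) (Fin 2) ℂ) 0) Y i
    ∃ W₀ : (PBond (F.P K) 0 → Matrix (Fin 2) (Fin 2) ℂ) → (PBond (F.P K) 0 → Matrix (Fin 2) (Fin 2) ℂ),
      (∀ A δ : PBond (F.P K) 0 → Matrix (Fin 2) (Fin 2) ℂ, fderiv ℂ (fun A : PBond (F.P K) 0 → Matrix (Fin 2) (Fin 2) ℂ => ∑ p : Plaq (F.P K) 0, (1 - (2 : ℂ)⁻¹ * Matrix.trace (NormedSpace.exp ((Complex.I * (((((F.L : ℝ)⁻¹) ^ (K - n) : ℝ)) : ℂ)) • A ⟨p.src, p.μ⟩) * NormedSpace.exp ((Complex.I * (((((F.L : ℝ)⁻¹) ^ (K - n) : ℝ)) : ℂ)) • A ⟨p.src.shift p.μ, p.ν⟩) * NormedSpace.exp (-((Complex.I * (((((F.L : ℝ)⁻¹) ^ (K - n) : ℝ)) : ℂ)) • A ⟨p.src.shift p.ν, p.μ⟩)) * NormedSpace.exp (-((Complex.I * (((((F.L : ℝ)⁻¹) ^ (K - n) : ℝ)) :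 ℂ)) • A ⟨p.src, p.ν⟩))) + (2 : ℂ)⁻¹ * Matrix.trace (((Complex.I * (((((F.L : ℝ)⁻¹) ^ (K - n) : ℝ)) : ℂ)) • A ⟨p.src, p.μ⟩) + ((Complex.I * (((((F.L : ℝ)⁻¹) ^ (K - n) : ℝ)) : ℂ)) • A ⟨p.src.shift p.μ, p.ν⟩) + (-((Complex.I * (((((F.L : ℝ)⁻¹) ^ (K - n) : ℝ)) : ℂ)) • A ⟨p.src.shift p.ν, p.μ⟩)) + (-((Complex.I * (((((F.L : ℝ)⁻¹) ^ (K - n) : ℝ)) : ℂ)) • A ⟨p.src, p.ν⟩))) + (4 : ℂ)⁻¹ * Matrix.trace ((((Complex.I * (((((F.L : ℝ)⁻¹) ^ (K - n) : ℝ)) : ℂ)) • A ⟨p.src, p.μ⟩) + ((Complex.I * (((((F.L : ℝ)⁻¹) ^ (K - n) : ℝ)) : ℂ)) • A ⟨p.src.shift p.μ, p.ν⟩) + (-((Complex.I * (((((F.L : ℝ)⁻¹) ^ (K - n) : ℝ)) : ℂ)) • A ⟨p.src.shift p.ν, p.μ⟩)) + (-((Complex.I * (((((F.L : ℝ)⁻¹)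 ^ (K - n) : ℝ)) : ℂ)) • A ⟨p.src, p.ν⟩))) ^ 2))) A δ =
        ((((F.L : ℝ)⁻¹) ^ (K - n) : ℝ) : ℂ) ^ 4 * ∑ b : PBond (F.P K) 0, Matrix.trace (W₀ A b * δ b)) ∧
      ∀ (Hs : (BondIdx D → Matrix (Fin 2) (Fin 2) ℂ) →ₗ[ℂ] (PBond (F.P K) 0 → Matrix (Fin 2) (Fin 2) ℂ)),
        (∀ (X : BondIdx D → Matrix (Fin 2) (Fin 2) ℂ) (t : ℝ), (∀ c, ‖X c‖ ≤ t) → ∀ b, w 1 b * ‖Hs X b‖ ≤ B₀ * t) →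
        (∀ (X : BondIdx D → Matrix (Fin 2) (Fin 2) ℂ) (t : ℝ), (∀ c, ‖X c‖ ≤ t) → ∀ (b : PBond (F.P K) 0) (ν : Fin 3),
          w 2 b * (F.L : ℝ) ^ (K - n) * ‖Hs X ⟨b.src.shift ν, b.dir⟩ - Hs X b‖ ≤ B₀ * t) →
        ∀ (E : (PBond (F.P K) 0 → Matrix (Fin 2) (Fin 2) ℂ) → (PBond (F.P K) 0 → Matrix (Fin 2) (Fin 2) ℂ)),
          (∀ (Y : PBond (F.P K) 0 → Matrix (Fin 2) (Fin 2) ℂ) (r' : ℝ), r' < Rs / 4 → (∀ b, w 1 b * ‖Y b‖ ≤ r') →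
            (∀ (b : PBond (F.P K) 0) (ν : Fin 3), w 2 b * (F.L : ℝ) ^ (K - n) * ‖Y ⟨b.src.shift ν, b.dir⟩ - Y b‖ ≤ r') → ∀ b, w 3 b * ‖E Y b‖ ≤ C_E * r' ^ 2) →
          ∀ (Y : PBond (F.P K) 0 → Matrix (Fin 2) (Fin 2) ℂ) (r' : ℝ),
            r' < min (Rs / 8) (1 / (2 * (F.L : ℝ) * (1 + 4 * B₀ * (16 * (F.L : ℝ) / Rs) * (Rs / 8)))) →
            (∀ b, w 1 b * ‖Y b‖ ≤ r') →
            (∀ (b : PBond (F.P K) 0) (ν : Fin 3), w 2 b * (F.L : ℝ) ^ (K - n) * ‖Y ⟨b.src.shift ν, b.dir⟩ - Y b‖ ≤ r') →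
              ∀ b, w 3 b * ‖(W₀ (Y - Hs (C Y)) + E Y) b‖ ≤
                (12 * ((F.L : ℝ) ^ 3 * (1428 + (F.L : ℝ))) * (1 + 4 * B₀ * (16 * (F.L : ℝ) / Rs) * (Rs / 8)) ^ 2 + C_E) * r' ^ 2 := by
  intro D Rs C
  -- the two suppliers of record
  obtain ⟨W₀, hgrad, -, -, hW₀q⟩ := FlatProp4Bg1.exists_gradient_weighted98_cubeSeq_T3 F n K x₀ ρ S M hM hS hw
  have hAdm : Adm22 D R' M := FlatCubeSequenceAdm.adm22_cubeSeqMT3 F n K x₀ ρ hM hRS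
  obtain ⟨-, hCq⟩ := chartRemainderFlat_hCd_hCq_B1 F n K hR'L hM D rfl hAdm hw
  refine ⟨W₀, hgrad, fun Hs hHB hHG E hE => ?_⟩
  have hL1 : (1 : ℝ) ≤ F.L := by exact_mod_cast F.hL.2.le
  have hL0 : (0 : ℝ) < F.L := by positivity
  have hℓ0 : (0 : ℝ) ≤ ((((F.P K).d + 2) * (F.P K).L : ℕ) : ℝ) := by positivity
  have hRs0 : 0 < Rs := by
    show 0 < (16 * 3800 * ((((F.P K).d + 2) * (F.P K).L : ℕ) : ℝ) ^ 2 * (F.L : ℝ))⁻¹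
    have hℓ1 : (1 : ℝ) ≤ ((((F.P K).d + 2) * (F.P K).L : ℕ) : ℝ) := by
      exact_mod_cast Nat.one_le_iff_ne_zero.mpr (Nat.mul_ne_zero (by omega) (by have := (F.P K).hL.2; omega))
    positivity
  -- the generic currency: `κ = PBond × Fin 3`, `src p = p.1`, `tgt p = ⟨p.1₋ + e_ν, dir p.1⟩`, `w₀ = w 1`, `w₁ p = w 2 p.1·L^{K−n}`, `w₃ = w 3`
  let src : PBond (F.P K) 0 × Fin 3 → PBond (F.P K) 0 := fun p => p.1
  let tgt : PBond (F.P K) 0 × Fin 3 → PBond (F.P K) 0 := fun p => ⟨p.1.src.shift p.2, p.1.dir⟩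
  have hw0 : ∀ m b, 0 ≤ w m b := levWeight_nonneg hw
  have hLk : (0 : ℝ) ≤ (F.L : ℝ) ^ (K - n) := by positivity
  -- the unguarded two-row letter of `Hs` in the generic currency
  have hH' : ∀ (X : BondIdx D → Matrix (Fin 2) (Fin 2) ℂ) (t : ℝ), (∀ c, ‖X c‖ ≤ t) →
      (∀ b, w 1 b * ‖Hs X b‖ ≤ B₀ * t) ∧ ∀ p : PBond (F.P K) 0 × Fin 3, (w 2 p.1 * (F.L : ℝ) ^ (K - n)) * ‖Hs X (tgt p) - Hs X (src p)‖ ≤ B₀ * t :=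
    fun X t hX => ⟨hHB X t hX, fun p => hHG X t hX p.1 p.2⟩
  -- (55) on the chart of record: `‖C Y c‖ ≤ 4·(16L/Rs)·r'²` below `Rs/4` (only the `w 1` letter is used)
  have hD : ∀ (Y : PBond (F.P K) 0 → Matrix (Fin 2) (Fin 2) ℂ) (r' : ℝ), r' < Rs / 4 → (∀ b, w 1 b * ‖Y b‖ ≤ r') →
      (∀ p : PBond (F.P K) 0 × Fin 3, (w 2 p.1 * (F.L : ℝ) ^ (K - n)) * ‖Y (tgt p) - Y (src p)‖ ≤ r') →
      ∀ c, ‖C Y c‖ ≤ 4 * (16 * (F.L : ℝ) / Rs) * r' ^ 2 := by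
    intro Y r' hr' hY _ c
    have h := hCq Y r' hr' hY c
    have e : 4 * (16 * (F.L : ℝ) / Rs) = 64 * (F.L : ℝ) / Rs := by ring
    rw [e]; exact h
  -- dictionaries between the `∀ b ν` and `∀ p` gradient letters
  have ofP : ∀ (Y : PBond (F.P K) 0 → Matrix (Fin 2) (Fin 2) ℂ) (r : ℝ),
      (∀ p : PBond (F.P K) 0 × Fin 3, (w 2 p.1 * (F.L : ℝ) ^ (K - n)) * ‖Y (tgt p) - Y (src p)‖ ≤ r) →
      ∀ (b : PBond (F.P K) 0) (ν : Fin 3), w 2 b * (F.L : ℝ) ^ (K - n) * ‖Y ⟨b.src.shift ν, b.dir⟩ - Y b‖ ≤ r := fun Y r h b ν => h (b, ν)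
  intro Y r' hr' h1 h2 b
  have hθ : (1 + 4 * B₀ * (16 * (F.L : ℝ) / Rs) * (Rs / 8)) * min (Rs / 8) (1 / (2 * (F.L : ℝ) * (1 + 4 * B₀ * (16 * (F.L : ℝ) / Rs) * (Rs / 8)))) ≤
      1 / (2 * (F.L : ℝ)) := by
    have hθ0 : 0 < 1 + 4 * B₀ * (16 * (F.L : ℝ) / Rs) * (Rs / 8) := by positivity
    calc (1 + 4 * B₀ * (16 * (F.L : ℝ) / Rs) * (Rs / 8)) * min (Rs / 8) (1 / (2 * (F.L : ℝ) * (1 + 4 * B₀ * (16 * (F.L : ℝ) / Rs) * (Rs / 8))))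
        ≤ (1 + 4 * B₀ * (16 * (F.L : ℝ) / Rs) * (Rs / 8)) * (1 / (2 * (F.L : ℝ) * (1 + 4 * B₀ * (16 * (F.L : ℝ) / Rs) * (Rs / 8)))) :=
          mul_le_mul_of_nonneg_left (min_le_right _ _) hθ0.le
      _ = 1 / (2 * (F.L : ℝ)) := by field_simp
  exact FlatProp4Dressing.hWq_of_dressing src tgt (w 1) (w 3) (fun p => w 2 p.1 * (F.L : ℝ) ^ (K - n))
    (fun Y => W₀ (Y - Hs (C Y)) + E Y) W₀ E Hs C (C₀ := 12 * ((F.L : ℝ) ^ 3 * (1428 + (F.L : ℝ)))) (a₀ := 1 / (2 * (F.L : ℝ)))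
    (C_E := C_E) (B_H := B₀) (C₂ := 16 * (F.L : ℝ) / Rs) (R := Rs / 4) (R₀ := Rs / 8)
    (a₃ := min (Rs / 8) (1 / (2 * (F.L : ℝ) * (1 + 4 * B₀ * (16 * (F.L : ℝ) / Rs) * (Rs / 8)))))
    (fun _ => rfl) (fun Y r hr hY1 hY2 => hW₀q Y r hr hY1 (ofP Y r hY2)) hH' hD
    (fun Y r hr hY1 hY2 => hE Y r hr hY1 (ofP Y r hY2))
    hB₀ (by positivity) (by positivity) (by linarith) (min_le_left _ _) hθ (hw0 1) (fun p => mul_nonneg (hw0 2 p.1) hLk) (hw0 3)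
    Y r' hr' h1 (fun p => h2 p.1 p.2) b

end Summit.QuantumFields.YangMills.Theorems.HalvingSize152Flat

end
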